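import Mathlib
import Literature.NumberTheory.LFunctions.Zhang2022.Section6Statements
import Literature.NumberTheory.LFunctions.Zhang2022.Section5Lemma51
import HarnessLib

/-!
# Zhang (2022), §6: line-integral tools for the `I′`-step of Lemma 6.1 (`Z22:§6.u015`)

Topic `Literature/NumberTheory/LFunctions/Zhang2022` (Landau–Siegel audit tree; verdict-neutral).
Y. Zhang, *Discrete mean estimates and the Landau–Siegel zero*, arXiv:2211.02515v1 (2022)
[Zhang2022LandauSiegel] — an unrefereed manuscript under adjudication; nothing here asserts or
denies its Theorems 1–2. Campaign D-0069.

The discharge OF RECORD of the node `Section6Statements.Step6u015` (§6 p. 32, tex L1774: "Replacing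
the segment `u = −1, |v| ≤ 𝓛²⁰` by `u = −1` and using the change of variable `w → −w`, we obtain
`I′ = −Z(s,ψ)N(1−s,ψ̄) + O(ε)`") is `Section6Statements.step6u015_holds` in the sibling module
`Section6Step15`. This module keeps only the reusable, kernel-checked tools about the objects of
(6.4) on the vertical line `Re w = −1` that were developed for the same step (campaign ruling
L2 DISCHARGE LEDGER #6 (R12): one discharge declaration, tools kept):

* `norm_Zfac_le_exp14` — `|Z(s,ψ)| ≤ e¹⁴` for `|σ − ½| < 2α`, `|t − 2πt₀| < 𝓛₁ + 2`, `𝓛 ≥ 3` (from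
  the tree's `GammaFactor.norm_Zfac_le_exp_of_abs_sub_half_le`, i.e. the (4.5)/Stirling mechanism,
  with `2α·log(pt/2π) ≤ 2π𝓛⁻⁹·2𝓛⁹`);
* `norm_headSum_le`, `norm_integrand64_le`, `continuous_integrand64_line`,
  `integrable_integrand64_line` — the (6.4)-integrand on `Re w = −1` has modulus
  `≤ (T³+1)T²e^{(1−v²)/(4𝓛³⁰)}`, is continuous and integrable;
* `norm_vseg_sub_vline_le` — "replacing the segment by `u = −1`": the two half-lines `|v| > 𝓛²⁰`
  contribute at most `(T³+1)T²e^{1/(4𝓛³⁰)}e^{−𝓛⁴⁰/(8𝓛³⁰)}√(8π𝓛³⁰)` (Gaussian tail);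
* `integrand64_reflect`, `vline_integrand64_eq` — "the change of variable `w → −w`": the line
  `Re w = −1` becomes `Re w = 1`, `ω₁` is even, `T^{−2w} = (T²)^{−w}`, and the Gaussian Perron
  formula of §4 (tree `GaussWeight.integral_sum_mul_kernel`) evaluates the full-line integral as
  `−Σ_{n<T³} ψ̄(n)n^{−(1−s)}g(T²/n)`;
* `Nchar_eq_sum`, `norm_vline_add_Nchar_le` — this differs from
  `−N(1−s,ψ̄) = −Σ_{n<2T²} ψ̄(n)n^{−(1−s)}g*(T²/n)` by the terms `2T² ≤ n < T³`, each of modulus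
  `≤ ½e^{−𝓛³⁰log²2}` by (4.3) (`gWeight_le`).

Theorems only; no new definitions or facts; axioms standard.

## References

* Y. Zhang, arXiv:2211.02515v1 (2022), §6 p. 32 (tex L1762–1775), (6.4); §4 (4.1), (4.3), (4.5).
  [cite: Zhang2022LandauSiegel, §6 p.32; §4 (4.1), (4.3), (4.5)]
-/

noncomputable section

open Complex Real ComplexConjugate MeasureTheory Set

namespace Literature.NumberTheory.LFunctions.Zhang2022.Section6Statements

open Skeleton

variable {D : ℕ}

/-! ### Elementary ranges -/

/-- The `t`-range: `|t − 2πt₀| < 𝓛₁ + 2` gives `4 ≤ t ≤ 8𝓛⁵¹⁹` (`𝓛 ≥ 3`).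
[cite: Zhang2022LandauSiegel, §2 (2.8)] -/
private theorem aux_t' {L t : ℝ} (hL : 3 ≤ L) (ht : |t - 2 * π * L ^ 519| < L ^ 405 + 2) :
    4 ≤ t ∧ t ≤ 8 * L ^ 519 := by
  have hL1 : 1 ≤ L := by linarith
  have h114 : 9 ≤ L ^ 114 := by
    have h : L ^ 2 ≤ L ^ 114 := pow_le_pow_right₀ hL1 (by norm_num)
    nlinarith
  have h405 : L ^ 405 + 2 ≤ L ^ 519 := by
    have h1 : (1 : ℝ) ≤ L ^ 405 := one_le_pow₀ hL1
    calc L ^ 405 + 2 ≤ L ^ 405 * 9 := by nlinarith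
      _ ≤ L ^ 405 * L ^ 114 := by gcongr
      _ = L ^ 519 := by rw [← pow_add]
  have h519 : (1 : ℝ) ≤ L ^ 519 := one_le_pow₀ hL1
  obtain ⟨ht1, ht2⟩ := abs_lt.mp ht
  have hπa : 3 * L ^ 519 ≤ π * L ^ 519 :=
    mul_le_mul_of_nonneg_right Real.pi_gt_three.le (by positivity)
  have hπb : π * L ^ 519 ≤ 3.15 * L ^ 519 :=
    mul_le_mul_of_nonneg_right Real.pi_lt_d2.le (by positivity)
  exact ⟨by linarith, by linarith⟩

/-- The window `p ∼ P`: `P < p < P(1 + 𝓛⁻⁶⁸)`. [cite: Zhang2022LandauSiegel, §2 p.4] -/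
private theorem bigP_lt_and_lt' {D : ℕ} (x : Chr D) :
    bigP D < x.p ∧ (x.p : ℝ) < bigP D * (1 + (ell D ^ 68)⁻¹) := by
  have hm := x.mem
  rw [primeWindow, Finset.mem_filter, Finset.mem_Ioo] at hm
  have hP : 0 ≤ bigP D := (Real.exp_pos _).le
  exact ⟨(Nat.floor_lt hP).mp hm.1.1, Nat.lt_ceil.mp hm.1.2⟩

/-- **`|Z(s,ψ)| ≤ e¹⁴` on the range of Lemma 6.1** (`|σ − 1/2| < 2α`, `|t − 2πt₀| < 𝓛₁ + 2`,
`𝓛 ≥ 3`), from the tree's `norm_Zfac_le_exp_of_abs_sub_half_le` (`|Z| ≤ exp(|σ−½|(|log(pt/2π)| +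
14/t))`) with `|σ − ½| < 2π𝓛⁻⁹` and `log(pt/2π) ≤ 2𝓛⁹`. [cite: Zhang2022LandauSiegel, §4 (4.5)] -/
theorem norm_Zfac_le_exp14 {D : ℕ} (hL : 3 ≤ ell D) (x : Chr D) {σ t : ℝ}
    (hσ : |σ - 1 / 2| < 2 * alpha D) (ht : |t - 2 * π * t0 D| < ell1 D + 2) :
    ‖GammaFactor.Zfac x.ψ ((σ : ℂ) + t * I)‖ ≤ Real.exp 14 := by
  set L := ell D with hLdef
  have hL1 : 1 ≤ L := by linarith
  have hα : alpha D = π / L ^ 9 := by rw [alpha, bigP, Real.log_exp]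
  have hL9 : (3 : ℝ) ^ 9 ≤ L ^ 9 := pow_le_pow_left₀ (by norm_num) hL 9
  have hL9' : 0 < L ^ 9 := by positivity
  have h2α : 2 * alpha D ≤ 1 / 4 := by
    rw [hα, mul_div_assoc', div_le_iff₀ hL9']; nlinarith [Real.pi_lt_four]
  have hσ4 : |σ - 1 / 2| ≤ 1 / 4 := hσ.le.trans h2α
  rw [ell1, t0] at ht
  obtain ⟨ht4, ht8⟩ := aux_t' hL ht
  have ht0 : 0 < t := by linarith
  obtain ⟨hPp, hpP⟩ := bigP_lt_and_lt' x
  have hP0 : 0 < bigP D := Real.exp_pos _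
  have hp0 : (0 : ℝ) < x.p := hP0.trans hPp
  have hp2 : (2 : ℝ) ≤ x.p := by exact_mod_cast x.prime.two_le
  -- log(pt/2π) ∈ [0, 2L⁹]
  have hq1 : 1 ≤ (x.p : ℝ) * t / (2 * π) := by
    rw [le_div_iff₀ (by positivity)]; nlinarith [Real.pi_lt_four]
  have hlogp : Real.log (x.p : ℝ) ≤ L ^ 9 + 1 := by
    have h68 : (L ^ 68)⁻¹ ≤ 1 := inv_le_one_of_one_le₀ (one_le_pow₀ hL1)
    have h4 : (x.p : ℝ) ≤ bigP D * 2 :=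
      hpP.le.trans (mul_le_mul_of_nonneg_left (by linarith) hP0.le)
    calc Real.log (x.p : ℝ) ≤ Real.log (bigP D * 2) := Real.log_le_log hp0 h4
      _ = L ^ 9 + Real.log 2 := by rw [Real.log_mul hP0.ne' two_ne_zero, bigP, Real.log_exp]
      _ ≤ L ^ 9 + 1 := by linarith [Real.log_two_lt_d9]
  have hlogt : Real.log t ≤ 3 + 519 * L := by
    have h1 : Real.log t ≤ Real.log (8 * L ^ 519) := Real.log_le_log ht0 ht8
    rw [Real.log_mul (by norm_num) (by positivity), Real.log_pow] at h1
    have h8 : Real.log 8 ≤ 3 := by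
      have : Real.log 8 = 3 * Real.log 2 := by
        rw [show (8 : ℝ) = 2 ^ 3 by norm_num, Real.log_pow]; norm_num
      rw [this]; linarith [Real.log_two_lt_d9]
    have hLL : Real.log L ≤ L := (Real.log_le_sub_one_of_pos (by linarith)).trans (by linarith)
    push_cast at h1
    nlinarith
  have hlog : |Real.log ((x.p : ℝ) * t / (2 * π))| ≤ 2 * L ^ 9 := by
    rw [abs_of_nonneg (Real.log_nonneg hq1), Real.log_div (by positivity) (by positivity),
      Real.log_mul hp0.ne' ht0.ne']
    have h2π : 0 ≤ Real.log (2 * π) := Real.log_nonneg (by linarith [Real.pi_gt_three])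
    have h9L : 519 * L + 4 ≤ L ^ 9 := by
      have h8 : (3 : ℝ) ^ 8 ≤ L ^ 8 := pow_le_pow_left₀ (by norm_num) hL 8
      have : L ^ 9 = L ^ 8 * L := by ring
      rw [this]; nlinarith
    linarith
  have h14 : 14 / t ≤ 4 := by rw [div_le_iff₀ ht0]; linarith
  have hexp : |σ - 1 / 2| * (|Real.log ((x.p : ℝ) * t / (2 * π))| + 14 / t) ≤ 14 := by
    calc |σ - 1 / 2| * (|Real.log ((x.p : ℝ) * t / (2 * π))| + 14 / t)
        ≤ (2 * (π / L ^ 9)) * (2 * L ^ 9 + 4) := by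
          rw [← hα]
          exact mul_le_mul hσ.le (by linarith) (by positivity) (by linarith [abs_nonneg (σ - 1/2)])
      _ = 4 * π + 8 * π / L ^ 9 := by field_simp; ring
      _ ≤ 14 := by
          have : 8 * π / L ^ 9 ≤ 1 := by rw [div_le_iff₀ hL9']; nlinarith [Real.pi_lt_four]
          nlinarith [Real.pi_lt_d2]
  exact (GammaFactor.norm_Zfac_le_exp_of_abs_sub_half_le x.prim hσ4 ht4).trans
    (Real.exp_le_exp.mpr hexp)


/-! ### The integrand of `I′` on the line `Re w = −1`: size, continuity, integrability -/

/-- `−1 + iv ≠ 0`. [folklore] -/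
private theorem lineNegOne_ne_zero (v : ℝ) : (((-1 : ℝ) : ℂ) + (v : ℂ) * I) ≠ 0 := fun h => by
  have := congrArg Complex.re h; simp at this

/-- `1 ≤ |−1 + iv|` (`|Re w| ≤ |w|`). [folklore] -/
private theorem one_le_norm_lineNegOne (v : ℝ) : 1 ≤ ‖(((-1 : ℝ) : ℂ) + (v : ℂ) * I)‖ := by
  have h := Complex.abs_re_le_norm ((((-1 : ℝ) : ℂ) + (v : ℂ) * I))
  simpa using h

/-- `v ↦ −1 + iv` is continuous. [folklore] -/
private theorem continuous_lineNegOne : Continuous fun v : ℝ => (((-1 : ℝ) : ℂ) + (v : ℂ) * I) := by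
  fun_prop

/-- `|ψ̄(n)| ≤ 1`. [folklore] -/
private theorem norm_psiBarFn_le (x : Chr D) (n : ℕ) : ‖psiBarFn x n‖ ≤ 1 := by
  rw [psiBarFn, Complex.norm_conj]; exact DirichletCharacter.norm_le_one x.ψ _

/-- `|Σ_{n<T³} ψ̄(n)n^{−(1−s−w)}| ≤ T³ + 1` on `Re w = −1` for `σ < 1` (each term has modulus
`n^{σ−2} ≤ 1`). [cite: Zhang2022LandauSiegel, §6 (6.4) p.32] -/
theorem norm_headSum_le (x : Chr D) {s : ℂ} (hσ : s.re < 2) (v : ℝ) :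
    ‖headSum x (bigT D ^ 3) s ((((-1 : ℝ) : ℂ) + (v : ℂ) * I))‖ ≤ bigT D ^ 3 + 1 := by
  have hT : 0 < bigT D := Real.exp_pos _
  have hT3 : 0 ≤ bigT D ^ 3 := by positivity
  unfold headSum
  calc ‖∑ n ∈ Finset.Ico 1 ⌈bigT D ^ 3⌉₊, psiBarFn x n * (n : ℂ) ^ (-(1 - s - (((-1 : ℝ) : ℂ) + (v : ℂ) * I)))‖
      ≤ ∑ n ∈ Finset.Ico 1 ⌈bigT D ^ 3⌉₊, (1 : ℝ) := by
        refine norm_sum_le_of_le _ fun n hn => ?_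
        rw [Finset.mem_Ico] at hn
        have hn0 : 0 < n := by omega
        have hn1 : (1 : ℝ) ≤ n := by exact_mod_cast hn0
        rw [norm_mul, Complex.norm_natCast_cpow_of_pos hn0]
        have hre : (-(1 - s - (((-1 : ℝ) : ℂ) + (v : ℂ) * I))).re ≤ 0 := by
          simp; linarith
        exact mul_le_one₀ (norm_psiBarFn_le x n) (Real.rpow_nonneg (Nat.cast_nonneg n) _)
          (Real.rpow_le_one_of_one_le_of_nonpos hn1 hre)
    _ = ((⌈bigT D ^ 3⌉₊ - 1 : ℕ) : ℝ) := by simp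
    _ ≤ bigT D ^ 3 + 1 := by
        have h1 : ((⌈bigT D ^ 3⌉₊ - 1 : ℕ) : ℝ) ≤ ⌈bigT D ^ 3⌉₊ := by
          exact_mod_cast Nat.sub_le _ _
        exact h1.trans (Nat.ceil_lt_add_one hT3).le

/-- `|integrand of (6.4) at −1+iv| ≤ (T³+1)T²·exp{(1 − v²)/(4𝓛³⁰)}` (`|T^{−2w}| = T²`,
`|ω₁(−1+iv)| = exp{(1−v²)/(4𝓛³⁰)}`, `|w| ≥ 1`). [cite: Zhang2022LandauSiegel, §6 (6.4) p.32] -/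
theorem norm_integrand64_le (x : Chr D) {s : ℂ} (hσ : s.re < 2) (v : ℝ) :
    ‖integrand64 x s ((((-1 : ℝ) : ℂ) + (v : ℂ) * I))‖
      ≤ (bigT D ^ 3 + 1) * bigT D ^ 2 * Real.exp ((1 - v ^ 2) / (4 * ell D ^ 30)) := by
  have hT : 0 < bigT D := Real.exp_pos _
  have h1 := norm_headSum_le x hσ v
  have h2 : ‖((bigT D : ℝ) : ℂ) ^ (-(2 * (((-1 : ℝ) : ℂ) + (v : ℂ) * I)))‖ = bigT D ^ 2 := by
    rw [Complex.norm_cpow_eq_rpow_re_of_pos hT]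
    have : (-(2 * (((-1 : ℝ) : ℂ) + (v : ℂ) * I))).re = (2 : ℕ) := by simp
    rw [this, Real.rpow_natCast]
  have h3 : ‖GaussWeight.omega1 (ell D ^ 30) ((((-1 : ℝ) : ℂ) + (v : ℂ) * I))‖ = Real.exp ((1 - v ^ 2) / (4 * ell D ^ 30)) := by
    rw [GaussWeight.norm_omega1]; norm_num
  have h4 := one_le_norm_lineNegOne v
  unfold integrand64
  rw [norm_div, norm_mul, norm_mul, h2, h3, div_le_iff₀ (by linarith)]
  have hE : 0 < Real.exp ((1 - v ^ 2) / (4 * ell D ^ 30)) := Real.exp_pos _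
  have hA : 0 ≤ (bigT D ^ 3 + 1) * bigT D ^ 2 * Real.exp ((1 - v ^ 2) / (4 * ell D ^ 30)) := by
    positivity
  calc ‖headSum x (bigT D ^ 3) s ((((-1 : ℝ) : ℂ) + (v : ℂ) * I))‖ * bigT D ^ 2 * Real.exp ((1 - v ^ 2) / (4 * ell D ^ 30))
      ≤ (bigT D ^ 3 + 1) * bigT D ^ 2 * Real.exp ((1 - v ^ 2) / (4 * ell D ^ 30)) := by
        gcongr
    _ = (bigT D ^ 3 + 1) * bigT D ^ 2 * Real.exp ((1 - v ^ 2) / (4 * ell D ^ 30)) * 1 := by ring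
    _ ≤ (bigT D ^ 3 + 1) * bigT D ^ 2 * Real.exp ((1 - v ^ 2) / (4 * ell D ^ 30)) * ‖(((-1 : ℝ) : ℂ) + (v : ℂ) * I)‖ :=
        mul_le_mul_of_nonneg_left h4 hA

/-- The (6.4)-integrand is continuous along `Re w = −1`.
[cite: Zhang2022LandauSiegel, §6 p.31 (6.4)] -/
theorem continuous_integrand64_line (x : Chr D) (s : ℂ) :
    Continuous fun v : ℝ => integrand64 x s ((((-1 : ℝ) : ℂ) + (v : ℂ) * I)) := by
  have hT : (((bigT D : ℝ) : ℂ)) ≠ 0 := ofReal_ne_zero.mpr (Real.exp_pos _).ne'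
  have hw := continuous_lineNegOne
  unfold integrand64 headSum GaussWeight.omega1
  refine Continuous.div ?_ hw lineNegOne_ne_zero
  refine Continuous.mul (Continuous.mul ?_ ?_) ?_
  · refine continuous_finsetSum _ fun n hn => ?_
    rw [Finset.mem_Ico] at hn
    have hn0 : (n : ℂ) ≠ 0 := Nat.cast_ne_zero.mpr (by omega)
    exact continuous_const.mul (Continuous.const_cpow (by fun_prop) (Or.inl hn0))
  · exact Continuous.const_cpow (by fun_prop) (Or.inl hT)
  · exact Continuous.cexp (by fun_prop)

/-- The (6.4)-integrand is integrable along `Re w = −1` (Gaussian domination).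
[cite: Zhang2022LandauSiegel, §6 p.31 (6.4)] -/
theorem integrable_integrand64_line (x : Chr D) {s : ℂ} (hσ : s.re < 2) (hΛ : 0 < ell D ^ 30) :
    Integrable fun v : ℝ => integrand64 x s ((((-1 : ℝ) : ℂ) + (v : ℂ) * I)) := by
  set A : ℝ := (bigT D ^ 3 + 1) * bigT D ^ 2 with hA
  set b : ℝ := 1 / (4 * ell D ^ 30) with hb
  have hb0 : 0 < b := by positivity
  have hg : Integrable fun v : ℝ => A * (Real.exp b * Real.exp (-b * v ^ 2)) :=
    ((integrable_exp_neg_mul_sq hb0).const_mul _).const_mul _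
  refine hg.mono' (continuous_integrand64_line x s).aestronglyMeasurable
    (Filter.Eventually.of_forall fun v => ?_)
  have h := norm_integrand64_le x hσ v
  have he : Real.exp ((1 - v ^ 2) / (4 * ell D ^ 30)) = Real.exp b * Real.exp (-b * v ^ 2) := by
    rw [← Real.exp_add]; congr 1; rw [hb]; field_simp; ring
  rw [he] at h
  exact h


/-! ### The change of variable `w → −w` and the Perron formula for the full-line `I′`-integral -/

/-- Pointwise reflection: at `w = −1 + iv`, the (6.4)-integrand equals minus the `Re w = 1` Perron
integrand `(Σ_{n<T³} ψ̄(n)n^{−(1−s)−w'})·(T²)^{w'}ω₁(w')/w'` at `w' = −w = 1 − iv`.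
[cite: Zhang2022LandauSiegel, §6 p.32, tex L1773] -/
theorem integrand64_reflect (x : Chr D) (s : ℂ) (v : ℝ) :
    integrand64 x s ((((-1 : ℝ) : ℂ) + (v : ℂ) * I)) =
      -((∑ n ∈ Finset.Ico 1 ⌈bigT D ^ 3⌉₊,
          LSeries.term (psiBarFn x) ((1 - s) + (((1 : ℝ) : ℂ) + ((-v : ℝ) : ℂ) * I)) n) *
        GaussWeight.kernel (ell D ^ 30) 1 (bigT D ^ 2) (-v)) := by
  have hT : 0 < bigT D := Real.exp_pos _
  set w' : ℂ := ((1 : ℝ) : ℂ) + ((-v : ℝ) : ℂ) * I with hw'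
  have hww : w' = -(((-1 : ℝ) : ℂ) + (v : ℂ) * I) := by rw [hw']; push_cast; ring
  have hw0 : (((-1 : ℝ) : ℂ) + (v : ℂ) * I) ≠ 0 := lineNegOne_ne_zero v
  -- the Dirichlet polynomial
  have hsum : headSum x (bigT D ^ 3) s ((((-1 : ℝ) : ℂ) + (v : ℂ) * I)) =
      ∑ n ∈ Finset.Ico 1 ⌈bigT D ^ 3⌉₊, LSeries.term (psiBarFn x) ((1 - s) + w') n := by
    unfold headSum
    refine Finset.sum_congr rfl fun n hn => ?_
    rw [Finset.mem_Ico] at hn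
    have hn0 : n ≠ 0 := by omega
    rw [LSeries.term_of_ne_zero hn0, div_eq_mul_inv, ← cpow_neg]
    congr 2
    rw [hww]; ring
  -- the power of `T`
  have hpow : ((bigT D : ℝ) : ℂ) ^ (-(2 * (((-1 : ℝ) : ℂ) + (v : ℂ) * I))) = ((bigT D ^ 2 : ℝ) : ℂ) ^ w' := by
    rw [GaussWeight.cpow_eq_exp_log hT, GaussWeight.cpow_eq_exp_log (by positivity), Real.log_pow,
      hww]
    congr 1
    push_cast
    ring
  -- the Gaussian weight is even
  have hom : GaussWeight.omega1 (ell D ^ 30) ((((-1 : ℝ) : ℂ) + (v : ℂ) * I)) = GaussWeight.omega1 (ell D ^ 30) w' := by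
    unfold GaussWeight.omega1
    rw [hww, neg_sq]
  unfold integrand64 GaussWeight.kernel
  rw [hsum, hpow, hom]
  have hw'' : ((1 : ℝ) : ℂ) + ((-v : ℝ) : ℂ) * I = w' := rfl
  rw [hw'', hww]
  field_simp

/-- **The full-line `I′`-integral evaluated**: `(1/2πi)∫_{(−1)} (Σ_{n<T³} ψ̄(n)n^{−(1−s−w)})
T^{−2w}ω₁(w)dw/w = −Σ_{n<T³} ψ̄(n)n^{−(1−s)}g(T²/n)` — "using the change of variable `w → −w`"
and the Gaussian Perron formula (tree `GaussWeight.integral_sum_mul_kernel`).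
[cite: Zhang2022LandauSiegel, §6 p.32, tex L1773] -/
theorem vline_integrand64_eq (x : Chr D) (s : ℂ) (hΛ : 0 < ell D ^ 30) :
    vline (integrand64 x s) (-1) =
      -∑ n ∈ Finset.Ico 1 ⌈bigT D ^ 3⌉₊,
        LSeries.term (psiBarFn x) (1 - s) n * (GaussWeight.gWeight (ell D ^ 30) (bigT D ^ 2 / n) : ℂ) := by
  have hT : 0 < bigT D := Real.exp_pos _
  have hX : 0 < bigT D ^ 2 := by positivity
  set S := Finset.Ico 1 ⌈bigT D ^ 3⌉₊ with hS
  set H : ℝ → ℂ := fun u =>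
    (∑ n ∈ S, LSeries.term (psiBarFn x) ((1 - s) + (((1 : ℝ) : ℂ) + (u : ℂ) * I)) n) *
      GaussWeight.kernel (ell D ^ 30) 1 (bigT D ^ 2) u with hH
  have hpt : ∀ v : ℝ, integrand64 x s ((((-1 : ℝ) : ℂ) + (v : ℂ) * I)) = -H (-v) := by
    intro v; rw [integrand64_reflect]
  have h1 : vline (integrand64 x s) (-1) = (1 / (2 * π) : ℂ) * ∫ v : ℝ, integrand64 x s ((((-1 : ℝ) : ℂ) + (v : ℂ) * I)) := by
    rw [vline]
  rw [h1]
  simp_rw [hpt]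
  rw [integral_neg, integral_neg_eq_self H volume, mul_neg,
    GaussWeight.integral_sum_mul_kernel hΛ one_pos hX S (psiBarFn x) (1 - s)]


/-! ### The tail `2T² ≤ n < T³`: `vline + N(1−s,ψ̄)` is exponentially small -/

/-- `N(1−s,ψ̄)` as a sum of Perron terms: `Σ_{n<2T²} ψ̄(n)n^{−(1−s)}g(T²/n)` (`g* = g` there).
[cite: Zhang2022LandauSiegel, §6 Lemma 6.1 p.31] -/
theorem Nchar_eq_sum (x : Chr D) (s : ℂ) :
    Nchar D (psiBarFn x) (1 - s) = ∑ n ∈ Finset.Ico 1 ⌈2 * bigT D ^ 2⌉₊,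
      LSeries.term (psiBarFn x) (1 - s) n * (GaussWeight.gWeight (ell D ^ 30) (bigT D ^ 2 / n) : ℂ) := by
  unfold Nchar
  refine Finset.sum_congr rfl fun n hn => ?_
  rw [Finset.mem_Ico] at hn
  have hn0 : n ≠ 0 := by omega
  have hnpos : (0 : ℝ) < n := by exact_mod_cast Nat.pos_of_ne_zero hn0
  have hnX : (n : ℝ) < 2 * bigT D ^ 2 := Nat.lt_ceil.mp hn.2
  have hg : gstar D (bigT D ^ 2 / n) = GaussWeight.gWeight (ell D ^ 30) (bigT D ^ 2 / n) := by
    rw [gstar, if_pos, gW]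
    rw [lt_div_iff₀ hnpos]; linarith
  rw [hg, LSeries.term_of_ne_zero hn0, cpow_neg]
  ring

/-- **`|vline + N(1−s,ψ̄)| ≤ (T³+1)·½e^{−𝓛³⁰log²2}`**: the two Perron sums differ exactly by the terms
`2T² ≤ n < T³`, each of modulus `≤ g(T²/n) ≤ ½e^{−𝓛³⁰log²(n/T²)} ≤ ½e^{−𝓛³⁰log²2}` by (4.3), for
`σ ≤ 1`, `T ≥ 2`. [cite: Zhang2022LandauSiegel, §6 p.32, tex L1774] -/
theorem norm_vline_add_Nchar_le (x : Chr D) {s : ℂ} (hσ : s.re ≤ 1) (hT2 : 2 ≤ bigT D)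
    (hΛ : 0 < ell D ^ 30) :
    ‖vline (integrand64 x s) (-1) + Nchar D (psiBarFn x) (1 - s)‖
      ≤ (bigT D ^ 3 + 1) * (1 / 2 * Real.exp (-(ell D ^ 30) * Real.log 2 ^ 2)) := by
  have hT : 0 < bigT D := by linarith
  set X : ℝ := bigT D ^ 2 with hXdef
  have hX : 0 < X := by positivity
  set S := Finset.Ico 1 ⌈bigT D ^ 3⌉₊ with hS
  set S' := Finset.Ico 1 ⌈2 * bigT D ^ 2⌉₊ with hS'
  set Φ : ℕ → ℂ := fun n =>
    LSeries.term (psiBarFn x) (1 - s) n * (GaussWeight.gWeight (ell D ^ 30) (X / n) : ℂ) with hΦ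
  have hsub : S' ⊆ S := by
    apply Finset.Ico_subset_Ico le_rfl
    apply Nat.ceil_mono
    nlinarith
  have h1 : vline (integrand64 x s) (-1) + Nchar D (psiBarFn x) (1 - s) = -∑ n ∈ S \ S', Φ n := by
    rw [vline_integrand64_eq x s hΛ, Nchar_eq_sum, ← Finset.sum_sdiff hsub]
    ring
  rw [h1, norm_neg]
  have hT3 : 0 ≤ bigT D ^ 3 := by positivity
  have hcard : ((S \ S').card : ℝ) ≤ bigT D ^ 3 + 1 := by
    have h2 : ((S \ S').card : ℝ) ≤ S.card := by exact_mod_cast Finset.card_le_card Finset.sdiff_subset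
    have h3 : (S.card : ℝ) = ((⌈bigT D ^ 3⌉₊ - 1 : ℕ) : ℝ) := by rw [hS, Nat.card_Ico]
    have h4 : ((⌈bigT D ^ 3⌉₊ - 1 : ℕ) : ℝ) ≤ ⌈bigT D ^ 3⌉₊ := by exact_mod_cast Nat.sub_le _ _
    linarith [(Nat.ceil_lt_add_one hT3).le]
  set c : ℝ := 1 / 2 * Real.exp (-(ell D ^ 30) * Real.log 2 ^ 2) with hc
  have hl2 : 0 < Real.log 2 := Real.log_pos (by norm_num)
  have hterm : ∀ n ∈ S \ S', ‖Φ n‖ ≤ c := by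
    intro n hn
    rw [Finset.mem_sdiff, hS, hS', Finset.mem_Ico, Finset.mem_Ico, not_and_or] at hn
    obtain ⟨⟨hn1, -⟩, hn2⟩ := hn
    have hn0 : n ≠ 0 := by omega
    have hnX : 2 * X ≤ n := by
      have h : ⌈2 * bigT D ^ 2⌉₊ ≤ n := by
        rcases hn2 with h | h <;> omega
      exact le_trans (Nat.le_ceil _) (by exact_mod_cast h)
    have hnpos : (0 : ℝ) < n := by positivity
    have hn1' : (1 : ℝ) ≤ n := by exact_mod_cast hn1
    have hratio : X / n ≤ 1 / 2 := by rw [div_le_iff₀ hnpos]; linarith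
    have hg0 : 0 < GaussWeight.gWeight (ell D ^ 30) (X / n) := GaussWeight.gWeight_pos hΛ _
    have hg1 := GaussWeight.gWeight_le hΛ (div_pos hX hnpos) (by linarith)
    -- `|term| ≤ 1`
    have ht1 : ‖LSeries.term (psiBarFn x) (1 - s) n‖ ≤ 1 := by
      rw [LSeries.norm_term_eq, if_neg hn0]
      have hden : 1 ≤ (n : ℝ) ^ (1 - s).re :=
        Real.one_le_rpow hn1' (by simp; linarith)
      exact div_le_one_of_le₀ ((norm_psiBarFn_le x n).trans hden) (by positivity)
    -- `g(X/n) ≤ ½ e^{−Λ log²2}`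
    have hlog : Real.log (X / n) ≤ -Real.log 2 := by
      have := Real.log_le_log (div_pos hX hnpos) hratio
      rwa [one_div, Real.log_inv] at this
    have hsq : Real.log 2 ^ 2 ≤ Real.log (X / n) ^ 2 := by nlinarith
    have hg2 : GaussWeight.gWeight (ell D ^ 30) (X / n) ≤ c := by
      refine hg1.trans ?_
      rw [hc]
      apply mul_le_mul_of_nonneg_left _ (by norm_num : (0 : ℝ) ≤ 1 / 2)
      exact Real.exp_le_exp.mpr (by nlinarith)
    rw [hΦ]
    simp only [norm_mul, Complex.norm_real, Real.norm_eq_abs, abs_of_pos hg0]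
    calc ‖LSeries.term (psiBarFn x) (1 - s) n‖ * GaussWeight.gWeight (ell D ^ 30) (X / n)
        ≤ 1 * c := mul_le_mul ht1 hg2 hg0.le zero_le_one
      _ = c := one_mul c
  calc ‖∑ n ∈ S \ S', Φ n‖ ≤ ∑ n ∈ S \ S', c := norm_sum_le_of_le _ hterm
    _ = (S \ S').card * c := by rw [Finset.sum_const, nsmul_eq_mul]
    _ ≤ (bigT D ^ 3 + 1) * c := mul_le_mul_of_nonneg_right hcard (by positivity)

/-! ### Segment versus line on `Re w = −1`: the Gaussian tail `|v| > 𝓛²⁰` -/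

/-- **"Replacing the segment `u = −1, |v| ≤ 𝓛²⁰` by `u = −1`"** costs at most
`(T³+1)T²e^{1/(4𝓛³⁰)}e^{−𝓛⁴⁰/(8𝓛³⁰)}√(8π𝓛³⁰)`: outside the segment the integrand is bounded by its
Gaussian majorant with `v² ≥ 𝓛⁴⁰`. [cite: Zhang2022LandauSiegel, §6 p.32, tex L1773] -/
theorem norm_vseg_sub_vline_le (x : Chr D) {s : ℂ} (hσ : s.re < 2) (hΛ : 0 < ell D ^ 30)
    (hV : 0 ≤ ell D ^ 20) :
    ‖vseg (integrand64 x s) (-1) (ell D ^ 20) - vline (integrand64 x s) (-1)‖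
      ≤ (bigT D ^ 3 + 1) * bigT D ^ 2 * Real.exp (1 / (4 * ell D ^ 30)) *
          Real.exp (-(ell D ^ 20) ^ 2 / (8 * ell D ^ 30)) * Real.sqrt (π / (1 / (8 * ell D ^ 30))) := by
  set Λ : ℝ := ell D ^ 30 with hΛdef
  set V : ℝ := ell D ^ 20 with hVdef
  set f : ℝ → ℂ := fun v => integrand64 x s ((((-1 : ℝ) : ℂ) + (v : ℂ) * I)) with hf
  set A : ℝ := (bigT D ^ 3 + 1) * bigT D ^ 2 with hA
  have hT : 0 < bigT D := Real.exp_pos _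
  have hA0 : 0 ≤ A := by positivity
  have hfi : Integrable f := integrable_integrand64_line x hσ hΛ
  set sI : Set ℝ := Set.Ioc (-V) V with hsI
  have hms : MeasurableSet sI := measurableSet_Ioc
  -- vseg and vline in terms of `f`
  have hseg : vseg (integrand64 x s) (-1) V = (1 / (2 * π) : ℂ) * ∫ v in sI, f v := by
    rw [vseg, intervalIntegral.integral_of_le (by linarith)]
  have hline : vline (integrand64 x s) (-1) = (1 / (2 * π) : ℂ) * ((∫ v in sI, f v) + ∫ v in sIᶜ, f v) := by
    rw [vline, integral_add_compl hms hfi]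
  rw [hseg, hline, mul_add, sub_add_cancel_left, norm_neg, norm_mul]
  have h2π : ‖(1 / (2 * π) : ℂ)‖ ≤ 1 := by
    rw [show (1 / (2 * π) : ℂ) = ((1 / (2 * π) : ℝ) : ℂ) by push_cast; ring, Complex.norm_real,
      Real.norm_eq_abs, abs_of_pos (by positivity)]
    rw [div_le_one (by positivity)]; linarith [Real.pi_gt_three]
  -- the Gaussian majorant outside the segment
  set b : ℝ := 1 / (8 * Λ) with hb
  have hb0 : 0 < b := by positivity
  set g : ℝ → ℝ := fun v => A * Real.exp (1 / (4 * Λ)) * Real.exp (-V ^ 2 / (8 * Λ)) *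
    Real.exp (-b * v ^ 2) with hg
  have hgi : Integrable g := (integrable_exp_neg_mul_sq hb0).const_mul _
  have hg0 : ∀ v, 0 ≤ g v := fun v => by rw [hg]; positivity
  have hbound : ∀ v ∈ sIᶜ, ‖f v‖ ≤ g v := by
    intro v hv
    rw [hsI, Set.mem_compl_iff, Set.mem_Ioc, not_and_or, not_lt, not_le] at hv
    have hv2 : V ^ 2 ≤ v ^ 2 := by
      rcases hv with h | h <;> nlinarith
    have h := norm_integrand64_le x hσ v
    rw [← hΛdef] at h
    have h8 : (0 : ℝ) < 8 * Λ := by positivity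
    have key : (1 - v ^ 2) / (4 * Λ) ≤ 1 / (4 * Λ) + -V ^ 2 / (8 * Λ) + -b * v ^ 2 := by
      have e1 : (1 - v ^ 2) / (4 * Λ) = (2 - 2 * v ^ 2) / (8 * Λ) := by
        field_simp; ring
      have e2 : 1 / (4 * Λ) + -V ^ 2 / (8 * Λ) + -b * v ^ 2 = (2 - V ^ 2 - v ^ 2) / (8 * Λ) := by
        rw [hb]; field_simp; ring
      rw [e1, e2]
      exact div_le_div_of_nonneg_right (by nlinarith) h8.le
    have hexp : Real.exp ((1 - v ^ 2) / (4 * Λ)) ≤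
        Real.exp (1 / (4 * Λ)) * Real.exp (-V ^ 2 / (8 * Λ)) * Real.exp (-b * v ^ 2) := by
      rw [← Real.exp_add, ← Real.exp_add]
      exact Real.exp_le_exp.mpr key
    calc ‖f v‖ ≤ A * Real.exp ((1 - v ^ 2) / (4 * Λ)) := by rw [hf, hA]; exact h
      _ ≤ A * (Real.exp (1 / (4 * Λ)) * Real.exp (-V ^ 2 / (8 * Λ)) * Real.exp (-b * v ^ 2)) :=
          mul_le_mul_of_nonneg_left hexp hA0
      _ = g v := by rw [hg]; ring
  calc ‖(1 / (2 * π) : ℂ)‖ * ‖∫ v in sIᶜ, f v‖ ≤ 1 * ‖∫ v in sIᶜ, f v‖ :=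
        mul_le_mul_of_nonneg_right h2π (norm_nonneg _)
    _ = ‖∫ v in sIᶜ, f v‖ := one_mul _
    _ ≤ ∫ v in sIᶜ, ‖f v‖ := norm_integral_le_integral_norm _
    _ ≤ ∫ v in sIᶜ, g v :=
        setIntegral_mono_on hfi.norm.integrableOn hgi.integrableOn hms.compl hbound
    _ ≤ ∫ v, g v := setIntegral_le_integral hgi (Filter.Eventually.of_forall hg0)
    _ = A * Real.exp (1 / (4 * Λ)) * Real.exp (-V ^ 2 / (8 * Λ)) * Real.sqrt (π / b) := by
        rw [hg, integral_const_mul, integral_gaussian]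


end Literature.NumberTheory.LFunctions.Zhang2022.Section6Statements
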